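import Summits.CriticalPhenomena.PercolationContinuityZ3.Theorems.PercNearOneGluingNoHeavyLowerTailSahiTransportCascade
import Summits.CriticalPhenomena.PercolationContinuityZ3.Theorems.PercNearOneGluingNoHeavyLowerTailSahiTransportJRFour

/-!
# `NoHeavyLowerTail` (crux stmt-CriticalPhenomena-4575), Sahi / Kahn positivity: TRANSPORT CERTIFICATES (V-d) —
# Kahn's Conjecture 5 for every first slot obtained from a junta on at most four coordinates by adjoining coordinates one at a time

Support file (cell `prim-l12`, seat P3, gen 7; `--supports stmt-CriticalPhenomena-4575`).  No `sorry`, no named facts; computational only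
through the imported `|A| ≤ 4` certificates (`…SahiTransportJRFour.exists_transportCert_four`, kernel-checked tables).  New mathematics.

`…SahiTransportCascade` proved that transport certificates survive adjoining a fresh coordinate by `∧` or `∨` (`transportCert_cascadeOver`);
`…SahiTransportJRFour` certified EVERY increasing pattern event on four coordinates at every parameter vector.  Together
(`transportCert_cascadeOver_four`, **`sahiE_three_nonneg_of_cascadeOver_four`**): for every increasing `P ⊆ 2^{Fin 4}` and every word
`w ∈ {∧,∨}^j`, the event `(⋯((P ∘₀ x₄) ∘₁ x₅)⋯) ∘_{j-1} x_{3+j}` carries a transport certificate at every `p`, hence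
`E₃(1_H, 1_U, 1_V) ≥ 0` for every such junta `H` (e.g. `maj(a,b,c) ∧ d ∨ e`, `((a ∨ b)(c ∨ d) ∨ e) ∧ f ∧ g`, of any length) and ALL
increasing `U, V`, every dimension: Kahn's Conjecture 5 / Sahi's `C₃` on an infinite family of first slots of unbounded support beyond the
cascades. [this work]
-/

noncomputable section

open scoped Classical

namespace Summit.CriticalPhenomena.PercolationContinuityZ3.Theorems

namespace SahiTransportCert

open Finset
open SahiHittingSlot
open Literature.Combinatorics.Sahi2008
open Literature.Probability.Percolation.DecisionTree (ind)

/-- Every cascade over an increasing four-coordinate base carries a transport certificate at every parameter vector. [this work] -/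
theorem transportCert_cascadeOver_four {P : Set (Set (Fin 4))} (hP : IsUpperSet P) (j : ℕ) (w : Fin j → Bool) (q : Fin (4 + j) → unitInterval) :
    ∃ Kr, TransportCert q (cascadeOver P j w) Kr :=
  transportCert_cascadeOver hP (fun q' => SahiTransportJR.exists_transportCert_four q' hP) j w q

/-- **KAHN'S CONJECTURE 5 / SAHI'S `C₃` FOR CASCADES OVER FOUR-COORDINATE JUNTAS**: if the pattern event of the block-determined `H` is obtained
from an increasing event on the first four block coordinates by adjoining the remaining block coordinates one at a time (`∨` where `w i`, else `∧`),
then `E₃(1_H, 1_U, 1_V) ≥ 0` for ALL increasing `U, V` of `2^ι`. [this work] -/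
theorem sahiE_three_nonneg_of_cascadeOver_four {ι : Type} [Fintype ι] (p : ι → unitInterval) {j : ℕ} (e : Fin (4 + j) ↪ ι) {H : Set (Set ι)}
    (hH : Literature.Probability.Percolation.DeterminedBy H (Set.range e)) {P : Set (Set (Fin 4))} (hP : IsUpperSet P) (w : Fin j → Bool)
    (hc : pat e H = cascadeOver P j w) {U V : Set (Set ι)} (hU : IsUpperSet U) (hV : IsUpperSet V) :
    0 ≤ sahiE (bernoulliWeight p) 3 ![ind H, ind U, ind V] :=
  sahiE_three_nonneg_of_cascadeOver p e hH hP (fun q' => SahiTransportJR.exists_transportCert_four q' hP) w hc hU hV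

/-- The same in the tree's event vocabulary. [this work] -/
theorem sahiE3_nonneg_of_cascadeOver_four {ι : Type} [Fintype ι] (p : ι → unitInterval) {j : ℕ} (e : Fin (4 + j) ↪ ι) {H : Set (Set ι)}
    (hH : Literature.Probability.Percolation.DeterminedBy H (Set.range e)) {P : Set (Set (Fin 4))} (hP : IsUpperSet P) (w : Fin j → Bool)
    (hc : pat e H = cascadeOver P j w) {U V : Set (Set ι)} (hU : IsUpperSet U) (hV : IsUpperSet V) :
    0 ≤ Literature.Probability.LatticeModels.sahiE3 (Literature.Probability.LatticeModels.prodBernoulli p) H U V := by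
  rw [← sahiE_three_ind]
  exact sahiE_three_nonneg_of_cascadeOver_four p e hH hP w hc hU hV

end SahiTransportCert

end Summit.CriticalPhenomena.PercolationContinuityZ3.Theorems
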